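import Summits.AtomisticToContinuum.HydrodynamicLimit.Theorems.TwoClocksEquilibriumFastWindowLDBirthT12Thales
import HarnessLib

/-!
# The Thales/Lambert representation of one hard-sphere collision, II: the gain term in Lambert-disc
# form and the Bochner forms of the flux laws
# (helpers `t12_gainFst_disc`, `t12_gainSnd_disc` of the line `birth`, crux `TwoClocks.EquilibriumFastWindowLD`,
# stmt-AtomisticToContinuum-14440; infrastructure towards FF1 of the registered analytic sub-goal
# `t12_logLinearPreimage_and_dipoleModulus`)

Continuation of `…T12Thales`. Fix `v, w ∈ ℝ³`, `u := v - w`, `û := u/‖u‖`, and let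
`(e₁ û, e₂ û, û)` be the tree's measurable orthonormal frame (`Lambert.frame`, file
`Literature/Analysis/FluidPDE/DicedHardSphereDynamics.lean`; `Lambert.embed û p = p₀ e₁ û + p₁ e₂ û`
is the isometry `ℝ² ≅ û^⊥`). The gain term of the linearised hard-sphere operator at `v` is
`(K₂ψ)(v) = ∫ dM(w) ∫_{S²} (u·ω)₊ [ψ(v') + ψ(w')] dσ(ω)` (`kernelAction_eq_pieces_of_gaussGrowth`), and
the inner integrals are computed here EXACTLY, for every `w`:

* **Registered helpers `t12_gainFst_disc`, `t12_gainSnd_disc` — the gain term in Lambert-disc form.**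
  For every measurable `ψ : ℝ³ → ℝ` (no integrability needed: both sides are Bochner integrals
  against finite measures of the same integrand law),
  `∫_{S²} (u·ω)₊ ψ(v') dσ(ω) = ‖u‖ ∫_{‖p‖<1} ψ(w + ‖p‖² u - ‖u‖√(1-‖p‖²) embed û p) dp`,
  `∫_{S²} (u·ω)₊ ψ(w') dσ(ω) = ‖u‖ ∫_{‖p‖<1} ψ(w + (1-‖p‖²) u + ‖u‖√(1-‖p‖²) embed û p) dp`
  (`p ∈ ℝ²`, Lebesgue): the flux-weighted impact law is the uniform law of the Lambert disc
  (`lintegral_toSphere_cos_comp_coords`), and in the disc coordinates `p = coords û ω` of the impact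
  direction the outgoing velocities are the displayed points of the THALES SPHERE of `[w, v]`
  (`collide_fst_lift`, `collide_snd_lift`): distance `‖p‖·‖u‖` (resp. `√(1-‖p‖²)·‖u‖`) from `w`, height
  `‖p‖²‖u‖` (resp. `(1-‖p‖²)‖u‖`) above `w` along `û`, azimuth that of `-p` (resp. `p`); in polar
  coordinates `p = ρ(cos φ, sin φ)` this is the circle-average representation of the plan (FACT F at
  `w = 0`). `lintegral`/measure versions: `lintegral_hardSphereKernel_mul_comp_collide_fst/snd`,
  `fluxMeasure_map_collide_fst/snd`.
* **Zonal test functions** (`lintegral_hardSphereKernel_mul_zonal_fst/snd`): for `F(‖v' - w‖, ⟪v' - w, û⟫)`,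
  `∫ (u·ω)₊ F dσ = π‖u‖ ∫₀¹ 2ρ F(ρ‖u‖, ρ²‖u‖) dρ` (same law for `w'`), from the radius-ratio laws of
  `…T12Thales`.
* **Bochner forms of the flux laws** (`integral_hardSphereKernel_smul_comp_cosSq/radiusFst/radiusSnd`):
  e.g. `∫ (u·ω)₊ G(‖v' - w‖/‖u‖) dσ = π‖u‖ ∫₀¹ 2ρ G(ρ) dρ` for Banach-valued `G` a.e.-strongly measurable
  on `[0, 1]`, via the measure identities `t12_fluxMeasure_map_cosSq/radiusFst` of `…T12Thales`.

All statements are [folklore] (Lambert's cosine law; the Thales-sphere / "`c²` uniform" picture of a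
hard-sphere collision, Cercignani–Illner–Pulvirenti 1994 §3.1).
-/

noncomputable section

open MeasureTheory Real Set Filter Metric
open scoped ENNReal BigOperators InnerProductSpace
namespace Summit.AtomisticToContinuum.HydrodynamicLimit.Theorems.ClampedCorrectorBirth

open Literature.Analysis.FluidPDE Literature.MathematicalPhysics.KineticTheory

variable {v w : EuclideanSpace ℝ (Fin 3)}

/-! ### Bochner forms of the flux laws -/

/-- The flux weight `ω ↦ (u·ω)₊` is measurable in `ℝ≥0∞`. [folklore] -/
theorem measurable_ofReal_hardSphereKernel (v w : EuclideanSpace ℝ (Fin 3)) :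
    Measurable fun ω : sphere (0 : EuclideanSpace ℝ (Fin 3)) 1 => ENNReal.ofReal (hardSphereKernel (v, w) ω) := by
  unfold hardSphereKernel; fun_prop

/-- The flux-weighted Bochner integral is the Bochner integral against the flux measure. [folklore] -/
theorem integral_hardSphereKernel_smul_eq_integral_fluxMeasure {G : Type*} [NormedAddCommGroup G]
    [NormedSpace ℝ G] (v w : EuclideanSpace ℝ (Fin 3)) (Φ : sphere (0 : EuclideanSpace ℝ (Fin 3)) 1 → G) :
    ∫ ω, hardSphereKernel (v, w) ω • Φ ω ∂sphereMeasure =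
      ∫ ω, Φ ω ∂(sphereMeasure.withDensity fun ω => ENNReal.ofReal (hardSphereKernel (v, w) ω)) := by
  rw [integral_withDensity_eq_integral_toReal_smul (measurable_ofReal_hardSphereKernel v w)
    (Eventually.of_forall fun _ => ENNReal.ofReal_lt_top)]
  refine integral_congr_ae (Eventually.of_forall fun ω => ?_)
  dsimp only
  rw [ENNReal.toReal_ofReal (show 0 ≤ hardSphereKernel (v, w) ω from le_max_right _ _)]

/-- **Bochner form of a flux law.** If the image of the flux measure `(u·ω)₊ dσ` under a measurable
`f : S² → ℝ` is `π‖u‖ · ν`, then `∫ (u·ω)₊ F(f ω) dσ = π‖u‖ ∫ F dν` for every `F` a.e.-strongly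
measurable for `ν` (Banach-valued; both sides vanish together when `F ∉ L¹(ν)`). [folklore] -/
theorem integral_hardSphereKernel_smul_comp_of_map_eq {f : sphere (0 : EuclideanSpace ℝ (Fin 3)) 1 → ℝ}
    (hf : Measurable f) {ν : Measure ℝ}
    (hmap : (sphereMeasure.withDensity fun ω => ENNReal.ofReal (hardSphereKernel (v, w) ω)).map f =
      ENNReal.ofReal (π * ‖v - w‖) • ν)
    {G : Type*} [NormedAddCommGroup G] [NormedSpace ℝ G] {F : ℝ → G} (hF : AEStronglyMeasurable F ν) :
    ∫ ω, hardSphereKernel (v, w) ω • F (f ω) ∂sphereMeasure = (π * ‖v - w‖) • ∫ x, F x ∂ν := by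
  have hF' : AEStronglyMeasurable F
      ((sphereMeasure.withDensity fun ω => ENNReal.ofReal (hardSphereKernel (v, w) ω)).map f) := by
    rw [hmap]
    exact hF.smul_measure _
  rw [integral_hardSphereKernel_smul_eq_integral_fluxMeasure, ← integral_map hf.aemeasurable hF', hmap,
    integral_smul_measure, ENNReal.toReal_ofReal (by positivity)]

/-- **Bochner form of "the impact cosine squared is uniform"**: for `F` a.e.-strongly measurable on
`[0, 1]` (Banach-valued), `∫_{S²} (u·ω)₊ F(⟪u, ω⟫²/‖u‖²) dσ(ω) = π‖u‖ ∫₀¹ F(t) dt`. [folklore] -/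
theorem integral_hardSphereKernel_smul_comp_cosSq (v w : EuclideanSpace ℝ (Fin 3)) {G : Type*}
    [NormedAddCommGroup G] [NormedSpace ℝ G] {F : ℝ → G}
    (hF : AEStronglyMeasurable F (volume.restrict (Icc (0:ℝ) 1))) :
    ∫ ω, hardSphereKernel (v, w) ω • F (⟪v - w, (ω : EuclideanSpace ℝ (Fin 3))⟫_ℝ ^ 2 / ‖v - w‖ ^ 2)
        ∂sphereMeasure = (π * ‖v - w‖) • ∫ t in (0:ℝ)..1, F t := by
  rw [integral_hardSphereKernel_smul_comp_of_map_eq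
      (((measurable_sphere_inner (v - w)).pow_const 2).div_const _) (t12_fluxMeasure_map_cosSq v w) hF,
    intervalIntegral.integral_of_le zero_le_one, integral_Icc_eq_integral_Ioc]

/-- **Bochner form of a `2ρ dρ` law**: if the image of the flux measure under `f` is `π‖u‖ · 2ρ dρ` on
`[0, 1]`, then `∫ (u·ω)₊ F(f ω) dσ = π‖u‖ ∫₀¹ 2ρ F(ρ) dρ` (`F` a.e.-strongly measurable on `[0, 1]`).
[folklore] -/
theorem integral_hardSphereKernel_smul_comp_of_map_eq_twoMul {f : sphere (0 : EuclideanSpace ℝ (Fin 3)) 1 → ℝ}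
    (hf : Measurable f)
    (hmap : (sphereMeasure.withDensity fun ω => ENNReal.ofReal (hardSphereKernel (v, w) ω)).map f =
      ENNReal.ofReal (π * ‖v - w‖) •
        (volume.restrict (Icc (0:ℝ) 1)).withDensity fun ρ => ENNReal.ofReal (2 * ρ))
    {G : Type*} [NormedAddCommGroup G] [NormedSpace ℝ G] {F : ℝ → G}
    (hF : AEStronglyMeasurable F (volume.restrict (Icc (0:ℝ) 1))) :
    ∫ ω, hardSphereKernel (v, w) ω • F (f ω) ∂sphereMeasure =
      (π * ‖v - w‖) • ∫ ρ in (0:ℝ)..1, (2 * ρ) • F ρ := by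
  have hd : Measurable fun ρ : ℝ => ENNReal.ofReal (2 * ρ) :=
    ENNReal.measurable_ofReal.comp (measurable_const.mul measurable_id)
  rw [integral_hardSphereKernel_smul_comp_of_map_eq hf hmap
      (hF.mono_ac (withDensity_absolutelyContinuous _ _)),
    integral_withDensity_eq_integral_toReal_smul hd (Eventually.of_forall fun _ => ENNReal.ofReal_lt_top),
    intervalIntegral.integral_of_le zero_le_one, integral_Icc_eq_integral_Ioc.symm]
  congr 1
  refine setIntegral_congr_fun measurableSet_Icc fun ρ hρ => ?_
  rw [ENNReal.toReal_ofReal (by linarith [hρ.1])]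

/-- **Bochner form of the own radius-ratio law**: for `F` a.e.-strongly measurable on `[0, 1]`
(Banach-valued), `∫_{S²} (u·ω)₊ F(‖v' - w‖/‖u‖) dσ(ω) = π‖u‖ ∫₀¹ 2ρ F(ρ) dρ`. [folklore] -/
theorem integral_hardSphereKernel_smul_comp_radiusFst (v w : EuclideanSpace ℝ (Fin 3)) {G : Type*}
    [NormedAddCommGroup G] [NormedSpace ℝ G] {F : ℝ → G}
    (hF : AEStronglyMeasurable F (volume.restrict (Icc (0:ℝ) 1))) :
    ∫ ω, hardSphereKernel (v, w) ω • F (‖(collide ω (v, w)).1 - w‖ / ‖v - w‖) ∂sphereMeasure =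
      (π * ‖v - w‖) • ∫ ρ in (0:ℝ)..1, (2 * ρ) • F ρ :=
  integral_hardSphereKernel_smul_comp_of_map_eq_twoMul (measurable_norm_collide_fst_sub_snd_div v w)
    (t12_fluxMeasure_map_radiusFst v w) hF

/-- **Bochner form of the partner radius-ratio law**: for `F` a.e.-strongly measurable on `[0, 1]`
(Banach-valued), `∫_{S²} (u·ω)₊ F(‖w' - w‖/‖u‖) dσ(ω) = π‖u‖ ∫₀¹ 2ρ F(ρ) dρ`. [folklore] -/
theorem integral_hardSphereKernel_smul_comp_radiusSnd (v w : EuclideanSpace ℝ (Fin 3)) {G : Type*}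
    [NormedAddCommGroup G] [NormedSpace ℝ G] {F : ℝ → G}
    (hF : AEStronglyMeasurable F (volume.restrict (Icc (0:ℝ) 1))) :
    ∫ ω, hardSphereKernel (v, w) ω • F (‖(collide ω (v, w)).2 - w‖ / ‖v - w‖) ∂sphereMeasure =
      (π * ‖v - w‖) • ∫ ρ in (0:ℝ)..1, (2 * ρ) • F ρ :=
  integral_hardSphereKernel_smul_comp_of_map_eq_twoMul (measurable_norm_collide_snd_sub_snd_div v w)
    (fluxMeasure_map_radiusSnd v w) hF

/-! ### (Th3, zonal case) The gain term on axially zonal test functions -/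

/-- **The own gain term on zonal test functions.** For `v ≠ w` and measurable `F ≥ 0` on `ℝ × ℝ`:
`∫_{S²} (u·ω)₊ F(‖v' - w‖, ⟪v' - w, u⟫/‖u‖) dσ(ω) = π‖u‖ ∫₀¹ 2ρ F(ρ‖u‖, ρ²‖u‖) dρ` — a test function
of the distance to `w` and the height above `w` along `û` only (zonal about the axis of the Thales
sphere) needs no circle average. [folklore] -/
theorem lintegral_hardSphereKernel_mul_zonal_fst (hvw : v ≠ w) {F : ℝ × ℝ → ℝ≥0∞} (hF : Measurable F) :
    ∫⁻ ω, ENNReal.ofReal (hardSphereKernel (v, w) ω) *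
        F (‖(collide ω (v, w)).1 - w‖, ⟪(collide ω (v, w)).1 - w, v - w⟫_ℝ / ‖v - w‖) ∂sphereMeasure =
      ENNReal.ofReal (π * ‖v - w‖) *
        ∫⁻ ρ in Icc (0:ℝ) 1, ENNReal.ofReal (2 * ρ) * F (ρ * ‖v - w‖, ρ ^ 2 * ‖v - w‖) := by
  have hs : 0 < ‖v - w‖ := norm_pos_iff.2 (sub_ne_zero.2 hvw)
  have hm : Measurable fun ρ : ℝ => F (ρ * ‖v - w‖, ρ ^ 2 * ‖v - w‖) :=
    hF.comp ((measurable_id.mul_const _).prodMk ((measurable_id.pow_const 2).mul_const _))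
  rw [← lintegral_hardSphereKernel_mul_comp_radiusFst hvw hm]
  refine lintegral_congr fun ω => ?_
  rw [inner_collide_fst_sub_snd_eq_norm_sq, div_mul_cancel₀ _ hs.ne', div_pow]
  congr 3
  field_simp

/-- **The partner gain term on zonal test functions.** For `v ≠ w` and measurable `F ≥ 0` on
`ℝ × ℝ`: `∫_{S²} (u·ω)₊ F(‖w' - w‖, ⟪w' - w, u⟫/‖u‖) dσ(ω) = π‖u‖ ∫₀¹ 2ρ F(ρ‖u‖, ρ²‖u‖) dρ` — the
SAME law as for the own particle. [folklore] -/
theorem lintegral_hardSphereKernel_mul_zonal_snd (hvw : v ≠ w) {F : ℝ × ℝ → ℝ≥0∞} (hF : Measurable F) :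
    ∫⁻ ω, ENNReal.ofReal (hardSphereKernel (v, w) ω) *
        F (‖(collide ω (v, w)).2 - w‖, ⟪(collide ω (v, w)).2 - w, v - w⟫_ℝ / ‖v - w‖) ∂sphereMeasure =
      ENNReal.ofReal (π * ‖v - w‖) *
        ∫⁻ ρ in Icc (0:ℝ) 1, ENNReal.ofReal (2 * ρ) * F (ρ * ‖v - w‖, ρ ^ 2 * ‖v - w‖) := by
  have hs : 0 < ‖v - w‖ := norm_pos_iff.2 (sub_ne_zero.2 hvw)
  have hm : Measurable fun ρ : ℝ => F (ρ * ‖v - w‖, ρ ^ 2 * ‖v - w‖) :=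
    hF.comp ((measurable_id.mul_const _).prodMk ((measurable_id.pow_const 2).mul_const _))
  rw [← lintegral_hardSphereKernel_mul_comp_radiusSnd hvw hm]
  refine lintegral_congr fun ω => ?_
  rw [inner_collide_snd_sub_snd_eq_norm_sq, div_mul_cancel₀ _ hs.ne', div_pow]
  congr 3
  field_simp

/-! ### (Th3) The gain term in Lambert-disc form -/

/-- **The own outgoing velocity in Lambert-disc coordinates.** For `v ≠ w`, `‖p‖ ≤ 1` and the impact
direction `ω = lift û p` above the disc point `p`:
`v' = v - ⟪u, ω⟫ ω = w + ‖p‖² u - ‖u‖√(1 - ‖p‖²) embed û p` — the point of the Thales sphere of `[w, v]`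
at distance `‖p‖·‖u‖` from `w`. [folklore] -/
theorem collide_fst_lift (hvw : v ≠ w) {p : EuclideanSpace ℝ (Fin 2)} (hp : ‖p‖ ≤ 1) :
    v - ⟪v - w, Lambert.lift (‖v - w‖⁻¹ • (v - w)) p⟫_ℝ • Lambert.lift (‖v - w‖⁻¹ • (v - w)) p =
      w + (‖p‖ ^ 2) • (v - w) -
        (‖v - w‖ * √(1 - ‖p‖ ^ 2)) • Lambert.embed (‖v - w‖⁻¹ • (v - w)) p := by
  have hs : 0 < ‖v - w‖ := norm_pos_iff.2 (sub_ne_zero.2 hvw)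
  have hσ : √(1 - ‖p‖ ^ 2) ^ 2 = 1 - ‖p‖ ^ 2 := sq_sqrt (by nlinarith [norm_nonneg p])
  have hE : ⟪v - w, Lambert.embed (‖v - w‖⁻¹ • (v - w)) p⟫_ℝ = 0 := by
    have h0 := Lambert.inner_embed_self (‖v - w‖⁻¹ • (v - w)) p
    rw [real_inner_smul_right] at h0; rw [real_inner_comm]
    exact (mul_eq_zero.1 h0).resolve_left (inv_ne_zero hs.ne')
  have hself : ⟪v - w, ‖v - w‖⁻¹ • (v - w)⟫_ℝ = ‖v - w‖ := by
    rw [real_inner_smul_right, real_inner_self_eq_norm_sq, pow_two, ← mul_assoc,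
      inv_mul_cancel₀ hs.ne', one_mul]
  have hc : ⟪v - w, Lambert.lift (‖v - w‖⁻¹ • (v - w)) p⟫_ℝ = ‖v - w‖ * √(1 - ‖p‖ ^ 2) := by
    rw [Lambert.lift, inner_add_right, hE, inner_smul_right, hself, zero_add, mul_comm]
  rw [hc, Lambert.lift, smul_add, smul_smul,
    show ‖v - w‖ * √(1 - ‖p‖ ^ 2) * √(1 - ‖p‖ ^ 2) = √(1 - ‖p‖ ^ 2) ^ 2 * ‖v - w‖ by ring, hσ,
    mul_smul (1 - ‖p‖ ^ 2) ‖v - w‖ (‖v - w‖⁻¹ • (v - w)), smul_inv_smul₀ hs.ne']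
  module

/-- **The partner outgoing velocity in Lambert-disc coordinates.** For `v ≠ w`, `‖p‖ ≤ 1` and
`ω = lift û p`: `w' = w + ⟪u, ω⟫ ω = w + (1 - ‖p‖²) u + ‖u‖√(1 - ‖p‖²) embed û p` — the point of the
Thales sphere of `[w, v]` at distance `√(1 - ‖p‖²)·‖u‖` from `w`. [folklore] -/
theorem collide_snd_lift (hvw : v ≠ w) {p : EuclideanSpace ℝ (Fin 2)} (hp : ‖p‖ ≤ 1) :
    w + ⟪v - w, Lambert.lift (‖v - w‖⁻¹ • (v - w)) p⟫_ℝ • Lambert.lift (‖v - w‖⁻¹ • (v - w)) p =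
      w + (1 - ‖p‖ ^ 2) • (v - w) +
        (‖v - w‖ * √(1 - ‖p‖ ^ 2)) • Lambert.embed (‖v - w‖⁻¹ • (v - w)) p := by
  have hs : 0 < ‖v - w‖ := norm_pos_iff.2 (sub_ne_zero.2 hvw)
  have hσ : √(1 - ‖p‖ ^ 2) ^ 2 = 1 - ‖p‖ ^ 2 := sq_sqrt (by nlinarith [norm_nonneg p])
  have hE : ⟪v - w, Lambert.embed (‖v - w‖⁻¹ • (v - w)) p⟫_ℝ = 0 := by
    have h0 := Lambert.inner_embed_self (‖v - w‖⁻¹ • (v - w)) p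
    rw [real_inner_smul_right] at h0; rw [real_inner_comm]
    exact (mul_eq_zero.1 h0).resolve_left (inv_ne_zero hs.ne')
  have hself : ⟪v - w, ‖v - w‖⁻¹ • (v - w)⟫_ℝ = ‖v - w‖ := by
    rw [real_inner_smul_right, real_inner_self_eq_norm_sq, pow_two, ← mul_assoc,
      inv_mul_cancel₀ hs.ne', one_mul]
  have hc : ⟪v - w, Lambert.lift (‖v - w‖⁻¹ • (v - w)) p⟫_ℝ = ‖v - w‖ * √(1 - ‖p‖ ^ 2) := by
    rw [Lambert.lift, inner_add_right, hE, inner_smul_right, hself, zero_add, mul_comm]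
  rw [hc, Lambert.lift, smul_add, smul_smul,
    show ‖v - w‖ * √(1 - ‖p‖ ^ 2) * √(1 - ‖p‖ ^ 2) = √(1 - ‖p‖ ^ 2) ^ 2 * ‖v - w‖ by ring, hσ,
    mul_smul (1 - ‖p‖ ^ 2) ‖v - w‖ (‖v - w‖⁻¹ • (v - w)), smul_inv_smul₀ hs.ne']
  module

/-- **The flux-weighted law of an outgoing velocity is the lifted uniform disc law** (`lintegral` engine
of the disc forms): if `V : S² → ℝ³` agrees on the closed hemisphere `⟪û, ω⟫ ≥ 0` with `P ∘ coords û`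
for a measurable `Q : ℝ² → ℝ³` (`V ω = Q (coords û ω)` there), then
`∫ (u·ω)₊ F(V ω) dσ = ‖u‖ ∫_{‖p‖<1} F(Q p) dp` for measurable `F ≥ 0` (`v ≠ w`). [folklore] -/
theorem lintegral_hardSphereKernel_mul_comp_eq_ball (hvw : v ≠ w)
    {V : sphere (0 : EuclideanSpace ℝ (Fin 3)) 1 → EuclideanSpace ℝ (Fin 3)}
    {Q : EuclideanSpace ℝ (Fin 2) → EuclideanSpace ℝ (Fin 3)} (hQ : Measurable Q)
    (hVQ : ∀ ω : sphere (0 : EuclideanSpace ℝ (Fin 3)) 1,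
      0 ≤ ⟪‖v - w‖⁻¹ • (v - w), (ω : EuclideanSpace ℝ (Fin 3))⟫_ℝ →
        V ω = Q (Lambert.coords (‖v - w‖⁻¹ • (v - w)) ω))
    {F : EuclideanSpace ℝ (Fin 3) → ℝ≥0∞} (hF : Measurable F) :
    ∫⁻ ω, ENNReal.ofReal (hardSphereKernel (v, w) ω) * F (V ω) ∂sphereMeasure =
      ENNReal.ofReal ‖v - w‖ * ∫⁻ p in ball (0 : EuclideanSpace ℝ (Fin 2)) 1, F (Q p) := by
  have hs : 0 < ‖v - w‖ := norm_pos_iff.2 (sub_ne_zero.2 hvw)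
  have hû : ‖‖v - w‖⁻¹ • (v - w)‖ = 1 := norm_smul_inv_norm (sub_ne_zero.2 hvw)
  have hfm : Measurable fun p => F (Q p) := hF.comp hQ
  have hgm : Measurable fun ω : sphere (0 : EuclideanSpace ℝ (Fin 3)) 1 =>
      ENNReal.ofReal ⟪‖v - w‖⁻¹ • (v - w), (ω : EuclideanSpace ℝ (Fin 3))⟫_ℝ *
        F (Q (Lambert.coords (‖v - w‖⁻¹ • (v - w)) ω)) :=
    (measurable_sphere_inner _).ennreal_ofReal.mul
      (hfm.comp ((Lambert.measurable_coords _).comp measurable_subtype_coe))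
  have hpt : ∀ ω : sphere (0 : EuclideanSpace ℝ (Fin 3)) 1,
      ENNReal.ofReal (hardSphereKernel (v, w) ω) * F (V ω) =
        ENNReal.ofReal ‖v - w‖ * (ENNReal.ofReal ⟪‖v - w‖⁻¹ • (v - w), (ω : EuclideanSpace ℝ (Fin 3))⟫_ℝ *
          F (Q (Lambert.coords (‖v - w‖⁻¹ • (v - w)) ω))) := by
    intro ω
    rw [ofReal_hardSphereKernel_eq hvw, ENNReal.ofReal_mul hs.le, mul_assoc]
    rcases le_or_gt ⟪‖v - w‖⁻¹ • (v - w), (ω : EuclideanSpace ℝ (Fin 3))⟫_ℝ 0 with hle | hpos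
    · rw [ENNReal.ofReal_of_nonpos hle, zero_mul, zero_mul]
    · rw [hVQ ω hpos.le]
  simp_rw [hpt]
  rw [lintegral_const_mul _ hgm, show (sphereMeasure : Measure (sphere (0 : EuclideanSpace ℝ (Fin 3)) 1)) =
      volume.toSphere from rfl, lintegral_toSphere_cos_comp_coords hû hfm]

/-- **The own gain term in Lambert-disc form** (`lintegral`): for all `v, w` and measurable `F ≥ 0`,
`∫_{S²} (u·ω)₊ F(v') dσ(ω) = ‖u‖ ∫_{‖p‖<1} F(w + ‖p‖² u - ‖u‖√(1-‖p‖²) embed û p) dp`. [folklore] -/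
theorem lintegral_hardSphereKernel_mul_comp_collide_fst (v w : EuclideanSpace ℝ (Fin 3))
    {F : EuclideanSpace ℝ (Fin 3) → ℝ≥0∞} (hF : Measurable F) :
    ∫⁻ ω, ENNReal.ofReal (hardSphereKernel (v, w) ω) * F (collide ω (v, w)).1 ∂sphereMeasure =
      ENNReal.ofReal ‖v - w‖ * ∫⁻ p in ball (0 : EuclideanSpace ℝ (Fin 2)) 1,
        F (w + (‖p‖ ^ 2) • (v - w) -
          (‖v - w‖ * √(1 - ‖p‖ ^ 2)) • Lambert.embed (‖v - w‖⁻¹ • (v - w)) p) := by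
  rcases eq_or_ne v w with rfl | hvw
  · simp [hardSphereKernel]
  have hû : ‖‖v - w‖⁻¹ • (v - w)‖ = 1 := norm_smul_inv_norm (sub_ne_zero.2 hvw)
  -- the lifted parametrisation `Q p = v - ⟪u, lift û p⟫ lift û p` agrees with `v'` on the hemisphere
  have hQ : Measurable fun p : EuclideanSpace ℝ (Fin 2) =>
      v - ⟪v - w, Lambert.lift (‖v - w‖⁻¹ • (v - w)) p⟫_ℝ • Lambert.lift (‖v - w‖⁻¹ • (v - w)) p := by
    have hc := Lambert.continuous_lift (‖v - w‖⁻¹ • (v - w))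
    fun_prop
  rw [lintegral_hardSphereKernel_mul_comp_eq_ball hvw hQ (fun ω hω => by
    have hω1 : ‖(ω : EuclideanSpace ℝ (Fin 3))‖ = 1 := by simp
    simp only [Lambert.lift_coords hû hω1 hω, collide]) hF]
  congr 1
  refine setLIntegral_congr_fun measurableSet_ball fun p hp => ?_
  rw [collide_fst_lift hvw (le_of_lt (mem_ball_zero_iff.1 hp))]

/-- **The partner gain term in Lambert-disc form** (`lintegral`): for all `v, w` and measurable `F ≥ 0`,
`∫_{S²} (u·ω)₊ F(w') dσ(ω) = ‖u‖ ∫_{‖p‖<1} F(w + (1-‖p‖²) u + ‖u‖√(1-‖p‖²) embed û p) dp`. [folklore] -/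
theorem lintegral_hardSphereKernel_mul_comp_collide_snd (v w : EuclideanSpace ℝ (Fin 3))
    {F : EuclideanSpace ℝ (Fin 3) → ℝ≥0∞} (hF : Measurable F) :
    ∫⁻ ω, ENNReal.ofReal (hardSphereKernel (v, w) ω) * F (collide ω (v, w)).2 ∂sphereMeasure =
      ENNReal.ofReal ‖v - w‖ * ∫⁻ p in ball (0 : EuclideanSpace ℝ (Fin 2)) 1,
        F (w + (1 - ‖p‖ ^ 2) • (v - w) +
          (‖v - w‖ * √(1 - ‖p‖ ^ 2)) • Lambert.embed (‖v - w‖⁻¹ • (v - w)) p) := by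
  rcases eq_or_ne v w with rfl | hvw
  · simp [hardSphereKernel]
  have hû : ‖‖v - w‖⁻¹ • (v - w)‖ = 1 := norm_smul_inv_norm (sub_ne_zero.2 hvw)
  have hQ : Measurable fun p : EuclideanSpace ℝ (Fin 2) =>
      w + ⟪v - w, Lambert.lift (‖v - w‖⁻¹ • (v - w)) p⟫_ℝ • Lambert.lift (‖v - w‖⁻¹ • (v - w)) p := by
    have hc := Lambert.continuous_lift (‖v - w‖⁻¹ • (v - w))
    fun_prop
  rw [lintegral_hardSphereKernel_mul_comp_eq_ball hvw hQ (fun ω hω => by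
    have hω1 : ‖(ω : EuclideanSpace ℝ (Fin 3))‖ = 1 := by simp
    simp only [Lambert.lift_coords hû hω1 hω, collide]) hF]
  congr 1
  refine setLIntegral_congr_fun measurableSet_ball fun p hp => ?_
  rw [collide_snd_lift hvw (le_of_lt (mem_ball_zero_iff.1 hp))]

/-! ### Measure and Bochner forms of the disc representation -/

/-- A `lintegral` identity for all measurable `F ≥ 0` identifies the image of the flux measure under
`Φ : S² → ℝ³` with the image of `c · Leb|_{B(0,1)}` under `P : ℝ² → ℝ³`. [folklore] -/
theorem map_fluxMeasure_eq_map_ball_of_lintegral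
    {Φ : sphere (0 : EuclideanSpace ℝ (Fin 3)) 1 → EuclideanSpace ℝ (Fin 3)} (hΦ : Measurable Φ)
    {P : EuclideanSpace ℝ (Fin 2) → EuclideanSpace ℝ (Fin 3)} (hP : Measurable P) {c : ℝ≥0∞}
    (h : ∀ F : EuclideanSpace ℝ (Fin 3) → ℝ≥0∞, Measurable F →
      ∫⁻ ω, ENNReal.ofReal (hardSphereKernel (v, w) ω) * F (Φ ω) ∂sphereMeasure =
        c * ∫⁻ p in ball (0 : EuclideanSpace ℝ (Fin 2)) 1, F (P p)) :
    (sphereMeasure.withDensity fun ω => ENNReal.ofReal (hardSphereKernel (v, w) ω)).map Φ =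
      (c • volume.restrict (ball (0 : EuclideanSpace ℝ (Fin 2)) 1)).map P := by
  ext s hs
  rw [Measure.map_apply hΦ hs, Measure.map_apply hP hs, withDensity_apply _ (hΦ hs),
    ← lintegral_indicator (hΦ hs), Measure.smul_apply, smul_eq_mul, ← lintegral_indicator_one (hP hs)]
  have h1 : ∀ ω, (Φ ⁻¹' s).indicator (fun ω => ENNReal.ofReal (hardSphereKernel (v, w) ω)) ω =
      ENNReal.ofReal (hardSphereKernel (v, w) ω) * s.indicator 1 (Φ ω) := by
    intro ω
    by_cases hω : Φ ω ∈ s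
    · rw [indicator_of_mem (show ω ∈ Φ ⁻¹' s from hω), indicator_of_mem hω, Pi.one_apply, mul_one]
    · rw [indicator_of_notMem (show ω ∉ Φ ⁻¹' s from hω), indicator_of_notMem hω, mul_zero]
  have h2 : ∀ p, (P ⁻¹' s).indicator (1 : EuclideanSpace ℝ (Fin 2) → ℝ≥0∞) p =
      s.indicator (1 : EuclideanSpace ℝ (Fin 3) → ℝ≥0∞) (P p) := fun p =>
    indicator_comp_right P (g := (1 : EuclideanSpace ℝ (Fin 3) → ℝ≥0∞))
  simp_rw [h1, h2]
  exact h _ (measurable_one.indicator hs)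

/-- **Bochner form of a disc representation**: if the image of the flux measure under `Φ` is the image
of `c · Leb|_{B(0,1)}` under `P` (`0 ≤ c`), then `∫ (u·ω)₊ ψ(Φ ω) dσ = c ∫_{‖p‖<1} ψ(P p) dp` for every
measurable `ψ : ℝ³ → ℝ` (no integrability needed). [folklore] -/
theorem integral_hardSphereKernel_mul_comp_of_map_eq_map
    {Φ : sphere (0 : EuclideanSpace ℝ (Fin 3)) 1 → EuclideanSpace ℝ (Fin 3)} (hΦ : Measurable Φ)
    {P : EuclideanSpace ℝ (Fin 2) → EuclideanSpace ℝ (Fin 3)} (hP : Measurable P) {c : ℝ} (hc : 0 ≤ c)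
    (hmap : (sphereMeasure.withDensity fun ω => ENNReal.ofReal (hardSphereKernel (v, w) ω)).map Φ =
      (ENNReal.ofReal c • volume.restrict (ball (0 : EuclideanSpace ℝ (Fin 2)) 1)).map P)
    {ψ : EuclideanSpace ℝ (Fin 3) → ℝ} (hψ : Measurable ψ) :
    ∫ ω, hardSphereKernel (v, w) ω * ψ (Φ ω) ∂sphereMeasure =
      c * ∫ p in ball (0 : EuclideanSpace ℝ (Fin 2)) 1, ψ (P p) := by
  have h1 := integral_hardSphereKernel_smul_eq_integral_fluxMeasure v w (fun ω => ψ (Φ ω))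
  simp only [smul_eq_mul] at h1
  rw [h1, ← integral_map hΦ.aemeasurable hψ.aestronglyMeasurable, hmap,
    integral_map hP.aemeasurable hψ.aestronglyMeasurable, integral_smul_measure,
    ENNReal.toReal_ofReal hc, smul_eq_mul]

/-- **The flux-weighted law of the own outgoing velocity is the lifted disc law**: the image of
`(u·ω)₊ dσ(ω)` under `ω ↦ v'` is the image of `‖u‖ · Leb|_{B(0,1)}` under
`p ↦ w + ‖p‖² u - ‖u‖√(1-‖p‖²) embed û p`. [folklore] -/
theorem fluxMeasure_map_collide_fst (v w : EuclideanSpace ℝ (Fin 3)) :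
    (sphereMeasure.withDensity fun ω => ENNReal.ofReal (hardSphereKernel (v, w) ω)).map
        (fun ω => (collide ω (v, w)).1) =
      (ENNReal.ofReal ‖v - w‖ • volume.restrict (ball (0 : EuclideanSpace ℝ (Fin 2)) 1)).map
        (fun p => w + (‖p‖ ^ 2) • (v - w) -
          (‖v - w‖ * √(1 - ‖p‖ ^ 2)) • Lambert.embed (‖v - w‖⁻¹ • (v - w)) p) :=
  map_fluxMeasure_eq_map_ball_of_lintegral (by unfold collide; fun_prop)
    (by unfold Lambert.embed; fun_prop) fun _ hF => lintegral_hardSphereKernel_mul_comp_collide_fst v w hF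

/-- **The flux-weighted law of the partner outgoing velocity is the lifted disc law**: the image of
`(u·ω)₊ dσ(ω)` under `ω ↦ w'` is the image of `‖u‖ · Leb|_{B(0,1)}` under
`p ↦ w + (1-‖p‖²) u + ‖u‖√(1-‖p‖²) embed û p`. [folklore] -/
theorem fluxMeasure_map_collide_snd (v w : EuclideanSpace ℝ (Fin 3)) :
    (sphereMeasure.withDensity fun ω => ENNReal.ofReal (hardSphereKernel (v, w) ω)).map
        (fun ω => (collide ω (v, w)).2) =
      (ENNReal.ofReal ‖v - w‖ • volume.restrict (ball (0 : EuclideanSpace ℝ (Fin 2)) 1)).map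
        (fun p => w + (1 - ‖p‖ ^ 2) • (v - w) +
          (‖v - w‖ * √(1 - ‖p‖ ^ 2)) • Lambert.embed (‖v - w‖⁻¹ • (v - w)) p) :=
  map_fluxMeasure_eq_map_ball_of_lintegral (by unfold collide; fun_prop)
    (by unfold Lambert.embed; fun_prop) fun _ hF => lintegral_hardSphereKernel_mul_comp_collide_snd v w hF

/-- **Registered helper `t12_gainFst_disc` — the own gain term in Lambert-disc (Thales) form.** For all
`v, w ∈ ℝ³` (`u = v - w`, `û = u/‖u‖`, `embed û` the tree's isometry `ℝ² ≅ û^⊥`) and every measurable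
`ψ : ℝ³ → ℝ`:
`∫_{S²} (u·ω)₊ ψ(v') dσ(ω) = ‖u‖ ∫_{‖p‖<1} ψ(w + ‖p‖² u - ‖u‖ √(1 - ‖p‖²) embed û p) dp`,
`v' = (collide ω (v, w)).1`. The integrand on the right runs over the Thales sphere of `[w, v]`
(distance `‖p‖‖u‖` from `w`, height `‖p‖²‖u‖` along `û`); in polar coordinates `p = ρ(cos φ, sin φ)` it
is the circle average `π‖u‖ ∫₀¹ 2ρ ⨍dφ ψ(w + ρ²u - ρ√(1-ρ²)‖u‖(cos φ e₁ û + sin φ e₂ û)) dρ`, i.e. the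
`w`-resolved version of the far-field operator of FACT F (plan §2, §6 FF1); integrating `dM(w)` gives
the own piece of `K₂ψ`. No integrability hypothesis (both sides are `0` together otherwise). [folklore] -/
theorem t12_gainFst_disc : ∀ (v w : EuclideanSpace ℝ (Fin 3)) (ψ : EuclideanSpace ℝ (Fin 3) → ℝ), Measurable ψ → ∫ ω, Literature.MathematicalPhysics.KineticTheory.hardSphereKernel (v, w) ω * ψ (Literature.MathematicalPhysics.KineticTheory.collide ω (v, w)).1 ∂Literature.MathematicalPhysics.KineticTheory.sphereMeasure = ‖v - w‖ * ∫ p in Metric.ball (0 : EuclideanSpace ℝ (Fin 2)) 1, ψ (w + (‖p‖ ^ 2) • (v - w) - (‖v - w‖ * Real.sqrt (1 - ‖p‖ ^ 2)) • Literature.Analysis.FluidPDE.Lambert.embed (‖v - w‖⁻¹ • (v - w)) p) := by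
  intro v w ψ hψ
  exact integral_hardSphereKernel_mul_comp_of_map_eq_map (by unfold collide; fun_prop)
    (by unfold Lambert.embed; fun_prop) (norm_nonneg _) (fluxMeasure_map_collide_fst v w) hψ

/-- **Registered helper `t12_gainSnd_disc` — the partner gain term in Lambert-disc (Thales) form.** For
all `v, w ∈ ℝ³` and every measurable `ψ : ℝ³ → ℝ`:
`∫_{S²} (u·ω)₊ ψ(w') dσ(ω) = ‖u‖ ∫_{‖p‖<1} ψ(w + (1 - ‖p‖²) u + ‖u‖ √(1 - ‖p‖²) embed û p) dp`,
`w' = (collide ω (v, w)).2` (distance `√(1-‖p‖²)‖u‖` from `w`, height `(1-‖p‖²)‖u‖` along `û`: the same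
Thales sphere, radius ratio `√(1-‖p‖²)` instead of `‖p‖` — whence the common law `2ρ dρ` of both pieces
and the factor `4ρ` of FACT F); integrating `dM(w)` gives the partner piece of `K₂ψ`. [folklore] -/
theorem t12_gainSnd_disc : ∀ (v w : EuclideanSpace ℝ (Fin 3)) (ψ : EuclideanSpace ℝ (Fin 3) → ℝ), Measurable ψ → ∫ ω, Literature.MathematicalPhysics.KineticTheory.hardSphereKernel (v, w) ω * ψ (Literature.MathematicalPhysics.KineticTheory.collide ω (v, w)).2 ∂Literature.MathematicalPhysics.KineticTheory.sphereMeasure = ‖v - w‖ * ∫ p in Metric.ball (0 : EuclideanSpace ℝ (Fin 2)) 1, ψ (w + (1 - ‖p‖ ^ 2) • (v - w) + (‖v - w‖ * Real.sqrt (1 - ‖p‖ ^ 2)) • Literature.Analysis.FluidPDE.Lambert.embed (‖v - w‖⁻¹ • (v - w)) p) := by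
  intro v w ψ hψ
  exact integral_hardSphereKernel_mul_comp_of_map_eq_map (by unfold collide; fun_prop)
    (by unfold Lambert.embed; fun_prop) (norm_nonneg _) (fluxMeasure_map_collide_snd v w) hψ

end Summit.AtomisticToContinuum.HydrodynamicLimit.Theorems.ClampedCorrectorBirth

end
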